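import Summits.QuantumFields.YangMills.Theorems.BalabanUVNodesN07LocalLettersCoreOfDatumGauges
import Summits.QuantumFields.YangMills.Theorems.BalabanUVNodesN07PureGaugeShift168

/-!
# BalabanUVNodes ∕ N07 — [15] SECT. F AT THE OBJECTS OF RECORD, ROAD R0′: THE SPLIT-CLAUSE EDITION OF THE S6 INTERFACE — a local gauge whose potential is
# `A₀ + G` with `G` CURL-FREE (the fine pure gauge `∂μ = H(∂_cλ)` of the sheared datum) and the (165)-letters asked of `A₀` only; the per-plaquette ∕ per-bond and
# per-datum tokens next to `LocalLetters165TopStepCore` ∕ `DatumGauge165TopStepCore`, and their closer `… ⇒ HalvingStepTopCore` through dag-n07-w8's `regularTwo_of_curlFreeShift`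

Cell `pub-ymgap`, width seat `pub-ymgap-dag-n07-w4` gen 3 (director-ym №197 ∕ HUMAN RULING D-0149), node N07 = [15] = T. Bałaban, *The variational problem and background
fields in renormalization group method for lattice gauge theories*, Commun. Math. Phys. **102** (1985) 277–309 [Balaban1985Variational]; [6] = [Balaban1985RegularSpaces];
sub-target S6 (the HEAD of the one-step improvement), CLAIM-2 ∕ INTENT-2 of 2026-08-28 (bus I.30250; dag-n07-w8's hand-over I.30171 «the split edition … your lane's object»).
NEW Theorems-side leaf (`--supports stmt-QuantumFields-20542 --as helper`; one clause predicate + two displayed `Prop` tokens, NEVER asserted, + theorems); CONSUMED BY NAME,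
nothing modified: dag-n07-w8's p609716 `…N07PureGaugeShift168` (`regularTwo_of_curlFreeShift` — road R0′'s row (r2): a curl-free summand of the potential is invisible to the
LINEAR parts of (1.7)∕(1.9)), this seat's p584895 (`radius_descend`, `Letters10On`), p587134 (`LocalLetters165TopStepCore`), INTENT-1 `…N07LocalLettersCoreOfDatumGauges`
(`DatumGauge165TopStepCore`, `mem_cubeExt_cubeIdx`, `exists_within_three_of_mem_plaqsOf`, `exists_within_three_of_not_mem_bondsDeep_compl`), p594564 (`Sect2.exists_level_of_core_plaq
∕ _bond`), p606159 (`Sect2.mem_plaqInside ∕ bondsDeep_cover_box_propCubeP`), k0-s1-w3's `HalvingStepTopCore`, 33b's `Sect2.LocalGauge10On ∕ curlA ∕ codiffCurlA ∕ bondsDeep`.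
COUNT-NEUTRAL.

WHY.  Under the road of record R0′ (plan g83 WORDS-2, INBOX l.29399; n07-e § BRIDGE-92-B) the datum of the Sect. F heart at a big cube `□` is the SHEARED average
`V‴ = S_j(c₋)·V″(c)·S_j(c₊)⁻¹` (n07-e modules 41∕42), whose logarithm splits as `B‴ = B″ + ∂_cλ + N₂` ((r1), n07-w7); the flat minimiser sends the coarse gradient to a
FINE PURE GAUGE, `H(∂_cλ) = ∂μ` (n07-w7 `…N07FlatHOfCoarseGradient`), so the potential of the local gauge (152)∕(159) on `□` reads `A = A₀ + G`, `A₀ = A₁ + HB″ − HD(A₁ + HB″)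
(+ H N₂)` with the (165)-letters `t₀ = C·δ + θ·ε + Q·ε²` of the R4 edition, and `G = ∂μ` CURL-FREE but only `O(ε₀)` in size (the shear carries `≈ 9dL²B₁Mε₀` per coarse
bond, n07-e (R0) census).  Fed through 33b's ONE-threshold clause `Sect2.LocalGauge10On Y ξ t U`, `G` would enter module 31's `32tξ²` LINEARLY and the halving would fail;
dag-n07-w8's (r2) kernel `regularTwo_of_curlFreeShift` (p609716) shows that (1.7)∕(1.9) see a curl-free summand ONLY through the quadratic term: (2) holds inside `Y` at
`(2t₀ + 24t²)ξ²` ∕ `(t₀ + 32dt²)ξ³` when `‖A₀ + G‖, ‖∇^ξ(A₀ + G)‖ < t`, `‖∇^ξA₀‖, ‖∂^{ξ*}∂^ξA₀‖ < t₀`, `32t ≤ 1`.  THIS FILE is the matching edition of the S6 interface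
(n07-w8 I.30171: «under R0′ the token∕clause needs a SPLIT edition ∃ u A₀ G, … next to `LocalLetters165TopStepCore` — your lane's object»): the clause `LocalGaugeSplitOn Y ξ t t₀ U`
with p609716's binder shape BYTE FOR BYTE (§1), the per-plaquette ∕ per-bond token `LocalLettersSplitTopStepCore F N Sup B₃ C θ Q κ a₀ a₁` with `t := κ·ε_i` (the full
potential incl. the shear) and `t₀ := C·δ_i + θ·ε_i + Q·ε_i²` (§2), the closer to `HalvingStepTopCore` under print's (162)∕(163)∕(166)-type smallness in the constants of
p609716 (`4C ≤ B₃`, `16θ ≤ 1`, `(16Q + 1024κ²)·a₀ ≤ 1`, `32κ·a₀ ≤ 1`; §3), and the per-datum token `DatumGaugeSplitTopStepCore` with the ∃-introduction of INTENT-1 repeated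
for the split clause (§4).  The R4 edition is the case `G = 0` (`localGaugeSplitOn_of_localGauge10On`).

CONTENTS.  §0 plumbing.  §1 `LocalGaugeSplitOn` (def, predicate), `.of_le`, `localGaugeSplitOn_of_localGauge10On` (`G := 0`), ★ `regularTwo_of_localGaugeSplitOn` (p609716 through
the clause), ★★ `localGaugeSplitOn_of_eq159` (the per-datum ASSEMBLY under R0′: (159)'s three summands with `Letters10On` letters + a curl-free `G` with sup∕∇ letters ⇒ the
split clause — the split twin of p584895's `localGauge10On_of_eq159`), ★★ `localGaugeSplitOn_of_gauge152_eq159` (the same from S3's `u`, `A` and `A − G = A₁ + A₂ − A₃`).  §2 ★★ `LocalLettersSplitTopStepCore F N Sup B₃ C θ Q κ a₀ a₁` (def `Prop`, NEVER asserted), `localLettersSplitCore_of_localLetters165Core` (R4 ⇒ R0′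
edition, `κ ≥ C∕B₃ + θ + Q·a₀`).  §3 `thresholdSplit_plaq ∕ _bond` (real arithmetic), ★★★ `halvingStepTopCore_of_localLettersSplitCore`.  §4 ★★ `DatumGaugeSplitTopStepCore F N Sup Mc ρ
B₃ C θ Q κ a₀ a₁` (def `Prop`, NEVER asserted), ★★ `localLettersSplitCore_of_datumGaugeSplitCore`, ★★ `halvingStepTopCore_of_datumGaugeSplitCore`.

READINGS displayed (unchanged from p584895 ∕ p587134 ∕ INTENT-1 ∕ p609716): curve-form criticality (GAP-STATED(submersion)); level-dependent radii; the CORE restriction;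
door (a)'s window; the `Within 3` meeting condition; R0′'s split `A = A₀ + G` with sizes `t = κ·ε_i`, `t₀` — `G = H(∂_cλ) = ∂μ` and the sizes are rows (r0)–(r3), NOT here.
WHAT IS NOT HERE (honest scope): no token is discharged (their discharge IS the Sect. F chain on `□` under R0′, other seats'); nothing of (144)–(167) is proved; `HalvingStepTopCore`
is concluded FROM the new tokens (A6: LOCATED — antecedent = the token; binder block inhabited by n07-e's `…N07Prop8StepFlatWitness.halvingStepTop_binders_inhabited_flat`).

HONEST FRAMING: one predicate + two displayed `Prop`s (never asserted) + kernel bookkeeping (∃-packaging of p609716's door, real inequalities, the level descent and the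
∃-introductions by name); NOTHING of Bałaban's analysis is proved; `stub_prop8StepCoP13` ∕ K0⁷ ∕ K1⁷ NOT closed; N07 NOT discharged; counts unmoved (28∕28 · 5∕27); one finite 𝕋⁴
programme at fixed ε — R4 closes the conditional finite-𝕋⁴ rung `BalabanLadder.UV` ONLY, never the summit; the YM mass gap (Clay) is NOT proved by any of this; nothing continuum ∕
ℝ⁴ ∕ OS.  Three `def`s, no `instance` ∕ `notation` ∕ `sorry`.
-/

noncomputable section

namespace Summit.QuantumFields.YangMills.BalabanUVNodes.N07LocalLettersSplitCore

open scoped Matrix.Norms.L2Operator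
open Literature.MathematicalPhysics.QuantumFieldTheory.Balaban1983to89
open Literature.MathematicalPhysics.QuantumFieldTheory.Balaban1983to89.Node00
open Literature.MathematicalPhysics.QuantumFieldTheory.Balaban1983to89.T4Continuum (T4Family)
open Literature.MathematicalPhysics.QuantumFieldTheory.Balaban1983to89.B15DeterminingSets
open Literature.MathematicalPhysics.QuantumFieldTheory.Balaban1983to89.B12RegularSpaces111 (gaugeU expI grad)
open B15Eq112TorusCover (cover lift cover_lift)
open B14DomainGeom (Pt Within cubeIdx cubeIdx_le lt_cubeIdx)
open B14.Eq213MaximalDomains (side cubeExt)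
open B8Eq131Cubes (box)
open Summit.QuantumFields.YangMills.BalabanUVNodes.N07HalvingStepTopOfLocalLetters
open Summit.QuantumFields.YangMills.BalabanUVNodes.N07HalvingStepTopCoreOfLocalLetters
open Summit.QuantumFields.YangMills.BalabanUVNodes.N07LocalLettersCoreOfDatumGauges
open Summit.QuantumFields.YangMills.BalabanUVNodes.N07PureGaugeShift168

/-! ## §0  Plumbing -/

/-- `0 < η_i ≤ 1` (`η_i = L^{−i}`, `L ≥ 1`). [cite: Balaban1987RG1, (1.1) p.260 (bookkeeping)] -/
private theorem eta_pos_le_one' (P : Params) (i : ℕ) : 0 < P.eta i ∧ P.eta i ≤ 1 := by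
  have hL : (1 : ℝ) ≤ P.L := by exact_mod_cast P.L_pos
  unfold Params.eta
  exact ⟨pow_pos (inv_pos.mpr (lt_of_lt_of_le one_pos hL)) i, pow_le_one₀ (inv_nonneg.mpr (zero_le_one.trans hL)) (inv_le_one_of_one_le₀ hL)⟩

/-! ## §1  The split clause: a local gauge with potential `A₀ + G`, `G` curl-free, the (165)-letters asked of `A₀` only -/

section Clause

variable {P : Params} {N : ℕ} [NeZero N]

/-- **ROAD R0′'s LOCAL-GAUGE CLAUSE ON A SITE SET — SPLIT FORM** (the binder shape of dag-n07-w8's `regularTwo_of_curlFreeShift`, p609716, BYTE FOR BYTE, packaged as one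
predicate next to 33b's `Sect2.LocalGauge10On`): `U` is gauge-equivalent on the bonds of `Y` to `e^{iξ(A₀ + G)}` with `G` CURL-FREE (`∂^ξG = 0` everywhere — the fine pure gauge
`∂μ = H(∂_cλ)` of the sheared datum), the FULL potential and its gradient below `t` on `Y` (`‖A₀ + G‖ < t` on the bonds, `‖∇^ξ(A₀ + G)‖ < t` on the derivative pairs — `t` is
`O(ε₀)`, the shear's size), and the (165)-letters of `A₀` ALONE below `t₀` (`‖∇^ξA₀‖ < t₀` on the derivative pairs, `‖∂^{ξ*}∂^ξA₀‖ < t₀` on the deep bonds).  Print: (152) «U₁ =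
U′_k^u = e^{iηA}», (159) «A = A₁ + HB − HD(A₁ + HB)», (165); the split is road R0′'s reading of (154)₁ with the sheared datum (n07-e § BRIDGE-92-B; [I] p.253).
[cite: Balaban1985Variational, (152) p.301, (159) p.303, (165) p.304, (167)–(168) p.304; Balaban1985RegularSpaces, (1.2) p.76, (1.54) p.85] -/
def LocalGaugeSplitOn (Y : Set (Site P 0)) (ξ t t₀ : ℝ) (U : GaugeField P 0 (SU N)) : Prop :=
  ∃ u : GaugeTransf P 0 (SU N), ∃ A₀ G : PBond P 0 → MatA N,
    (∀ b ∈ (Sect2.regionOfSet P Y).bonds, gaugeU (fun x => ιSU N (u x)) (fun b' => ιSU N (U b')) b = expI ξ ((A₀ + G) b)) ∧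
    (∀ (y : Site P 0) (ν μ : Fin P.d), Sect2.curlA ξ G y ν μ = 0) ∧
    (∀ b ∈ (Sect2.regionOfSet P Y).bonds, ‖(A₀ + G) b‖ < t) ∧
    (∀ q ∈ (Sect2.regionOfSet P Y).dpairs, ‖grad ξ q.2.1 (fun y => (A₀ + G) ⟨y, q.2.2⟩) q.1‖ < t) ∧
    (∀ q ∈ (Sect2.regionOfSet P Y).dpairs, ‖grad ξ q.2.1 (fun y => A₀ ⟨y, q.2.2⟩) q.1‖ < t₀) ∧
    ∀ b ∈ Sect2.bondsDeep Y, ‖Sect2.codiffCurlA ξ A₀ b.src b.dir‖ < t₀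

omit [NeZero N] in
/-- The split clause is monotone in both thresholds. [cite: Balaban1985Variational, (165) p.304 (bookkeeping)] -/
theorem LocalGaugeSplitOn.of_le {Y : Set (Site P 0)} {ξ t t' t₀ t₀' : ℝ} {U : GaugeField P 0 (SU N)} (h : LocalGaugeSplitOn Y ξ t t₀ U) (ht : t ≤ t')
    (ht₀ : t₀ ≤ t₀') : LocalGaugeSplitOn Y ξ t' t₀' U := by
  obtain ⟨u, A₀, G, he, hG, hA, hdA, hdA₀, h10⟩ := h
  exact ⟨u, A₀, G, he, hG, fun b hb => (hA b hb).trans_le ht, fun q hq => (hdA q hq).trans_le ht, fun q hq => (hdA₀ q hq).trans_le ht₀,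
    fun b hb => (h10 b hb).trans_le ht₀⟩

omit [NeZero N] in
/-- **THE R4 EDITION IS THE CASE `G = 0`**: 33b's one-threshold clause `Sect2.LocalGauge10On Y ξ t₀ U` gives the split clause `LocalGaugeSplitOn Y ξ t t₀ U` for every
`t ≥ t₀` (`A₀ := A`, `G := 0`). [cite: Balaban1985Variational, (152) p.301, (165) p.304 (bookkeeping)] -/
theorem localGaugeSplitOn_of_localGauge10On {Y : Set (Site P 0)} {ξ t t₀ : ℝ} {U : GaugeField P 0 (SU N)} (h : Sect2.LocalGauge10On Y ξ t₀ U) (ht : t₀ ≤ t) :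
    LocalGaugeSplitOn Y ξ t t₀ U := by
  obtain ⟨u, A, he, hA, hdA, h10⟩ := h
  refine ⟨u, A, fun _ => 0, ?_, fun y ν μ => by simp [Sect2.curlA, grad], ?_, ?_, fun q hq => (hdA q hq).trans_le le_rfl, h10⟩
  · intro b hb; simpa using he b hb
  · intro b hb; simpa using (hA b hb).trans_le ht
  · intro q hq; simpa using (hdA q hq).trans_le ht

/-- ★ **(2) INSIDE `Y` FROM THE SPLIT CLAUSE** (dag-n07-w8's p609716 `regularTwo_of_curlFreeShift` read through the clause): `LocalGaugeSplitOn Y ξ t t₀ U` with `0 < ξ ≤ 1`,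
`32t ≤ 1` gives (1.7) at `(2t₀ + 24t²)·ξ²` on `plaqInside Y` and (1.9) at `(t₀ + 32·d·t²)·ξ³` on `Sect2.bondsDeep Y` — the curl-free summand enters only through `t²`.
[cite: Balaban1985Variational, (167)–(168) p.304, (2) p.278; Balaban1985RegularSpaces, (1.54) p.85, (1.7)–(1.9) p.77] -/
theorem regularTwo_of_localGaugeSplitOn {Y : Set (Site P 0)} {ξ t t₀ : ℝ} {U : GaugeField P 0 (SU N)} (h : LocalGaugeSplitOn Y ξ t t₀ U) (hξ : 0 < ξ)
    (hξ1 : ξ ≤ 1) (ht : 32 * t ≤ 1) :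
    PlaqSmallOn (plaqInside Y) ((2 * t₀ + 24 * t ^ 2) * ξ ^ 2) U ∧ Sect2.CoDivSmallOn (Sect2.bondsDeep Y) ((t₀ + 32 * P.d * t ^ 2) * ξ ^ 3) U := by
  obtain ⟨u, A₀, G, he, hG, hA, hdA, hdA₀, h10⟩ := h
  exact regularTwo_of_curlFreeShift u A₀ G he hG hA hdA hdA₀ h10 hξ hξ1 ht

omit [NeZero N] in
/-- ★★ **THE HEAD OF S6 UNDER ROAD R0′, GAUGE FORM** (the split twin of p584895's `localGauge10On_of_eq159`): a gauge `u` of `U` on `Y` whose potential is `A₀ + G` with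
`G` curl-free (the shear's fine pure gauge `∂μ`), `A₀ = A₁ + A₂ − A₃` print's (159) combination of three bond fields with letters below `t₁`, `t₂`, `t₃` (`A₁` by (158) ∕ piece 4,
`HB″` by (160)–(164), `HD(A₁ + HB″)` by Prop. 6), and `G`, `∇^ξG` below `t_G` on `Y`, gives the split clause `LocalGaugeSplitOn Y ξ (t₁ + t₂ + t₃ + t_G) (t₁ + t₂ + t₃) U` — the
(165)-letters are charged to `A₀` only, the shear only to the full-potential threshold.  This is the per-datum ASSEMBLY the supply rows (r0)–(r3) + S3∕S4∕S5 feed, by name.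
[cite: Balaban1985Variational, (152) p.301, (157)–(159) pp.302–303, (164)–(165) p.304; Balaban1985RegularSpaces, (1.2) p.76] -/
theorem localGaugeSplitOn_of_eq159 {Y : Set (Site P 0)} {ξ t₁ t₂ t₃ tG : ℝ} {U : GaugeField P 0 (SU N)} (u : GaugeTransf P 0 (SU N))
    {A₀ A₁ A₂ A₃ G : PBond P 0 → MatA N}
    (he : ∀ b ∈ (Sect2.regionOfSet P Y).bonds, gaugeU (fun x => ιSU N (u x)) (fun b' => ιSU N (U b')) b = expI ξ ((A₀ + G) b))
    (hG : ∀ (y : Site P 0) (ν μ : Fin P.d), Sect2.curlA ξ G y ν μ = 0)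
    (hA₀ : ∀ b, A₀ b = A₁ b + A₂ b - A₃ b) (h₁ : Letters10On Y ξ t₁ A₁) (h₂ : Letters10On Y ξ t₂ A₂) (h₃ : Letters10On Y ξ t₃ A₃)
    (hGsup : ∀ b ∈ (Sect2.regionOfSet P Y).bonds, ‖G b‖ < tG)
    (hdG : ∀ q ∈ (Sect2.regionOfSet P Y).dpairs, ‖grad ξ q.2.1 (fun y => G ⟨y, q.2.2⟩) q.1‖ < tG) :
    LocalGaugeSplitOn Y ξ (t₁ + t₂ + t₃ + tG) (t₁ + t₂ + t₃) U := by
  have hL := letters10On_of_eq159 hA₀ h₁ h₂ h₃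
  refine ⟨u, A₀, G, he, hG, fun b hb => ?_, fun q hq => ?_, hL.2.1, hL.2.2⟩
  · calc ‖(A₀ + G) b‖ = ‖A₀ b + G b‖ := rfl
      _ ≤ ‖A₀ b‖ + ‖G b‖ := norm_add_le _ _
      _ < t₁ + t₂ + t₃ + tG := add_lt_add (hL.1 b hb) (hGsup b hb)
  · have e : grad ξ q.2.1 (fun y => (A₀ + G) ⟨y, q.2.2⟩) q.1 =
        grad ξ q.2.1 (fun y => A₀ ⟨y, q.2.2⟩) q.1 + grad ξ q.2.1 (fun y => G ⟨y, q.2.2⟩) q.1 :=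
      grad_add ξ q.2.1 (fun y => A₀ ⟨y, q.2.2⟩) (fun y => G ⟨y, q.2.2⟩) q.1
    rw [e]
    exact (norm_add_le _ _).trans_lt (add_lt_add (hL.2.1 q hq) (hdG q hq))

omit [NeZero N] in
/-- ★★ **THE SAME ASSEMBLY FROM S3's GAUGE OF THE FULL POTENTIAL** (the shape S3 delivers: p592370 `exists_localGauge10_box_of_gaugedBoundB8` ∕ n07-w3's box tokens give `u`, `A`
with the gauge equation and the (152) letters `‖A‖, ‖∇^ξA‖ < t`, `t = O(ε₀)`): if `A − G = A₁ + A₂ − A₃` pointwise ((159) under R0′, `G = ∂μ` curl-free) with `Letters10On` letters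
`t₁`, `t₂`, `t₃` of the three summands, then `LocalGaugeSplitOn Y ξ t (t₁ + t₂ + t₃) U` (`A₀ := A − G`).
[cite: Balaban1985Variational, (152) p.301, (157)–(159) pp.302–303, (164)–(165) p.304; Balaban1985RegularSpaces, (1.2) p.76] -/
theorem localGaugeSplitOn_of_gauge152_eq159 {Y : Set (Site P 0)} {ξ t t₁ t₂ t₃ : ℝ} {U : GaugeField P 0 (SU N)} (u : GaugeTransf P 0 (SU N))
    {A A₁ A₂ A₃ G : PBond P 0 → MatA N}
    (he : ∀ b ∈ (Sect2.regionOfSet P Y).bonds, gaugeU (fun x => ιSU N (u x)) (fun b' => ιSU N (U b')) b = expI ξ (A b))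
    (hA : ∀ b ∈ (Sect2.regionOfSet P Y).bonds, ‖A b‖ < t)
    (hdA : ∀ q ∈ (Sect2.regionOfSet P Y).dpairs, ‖grad ξ q.2.1 (fun y => A ⟨y, q.2.2⟩) q.1‖ < t)
    (hG : ∀ (y : Site P 0) (ν μ : Fin P.d), Sect2.curlA ξ G y ν μ = 0)
    (h159 : ∀ b, A b - G b = A₁ b + A₂ b - A₃ b) (h₁ : Letters10On Y ξ t₁ A₁) (h₂ : Letters10On Y ξ t₂ A₂) (h₃ : Letters10On Y ξ t₃ A₃) :
    LocalGaugeSplitOn Y ξ t (t₁ + t₂ + t₃) U := by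
  have hL := letters10On_of_eq159 (A := fun b => A b - G b) h159 h₁ h₂ h₃
  have hAG : ((fun b => A b - G b) + G) = A := funext fun b => sub_add_cancel (A b) (G b)
  refine ⟨u, fun b => A b - G b, G, ?_, hG, ?_, ?_, hL.2.1, hL.2.2⟩
  · simpa only [hAG] using he
  · simpa only [hAG] using hA
  · simpa only [hAG] using hdA

end Clause

/-! ## §2  ★★ The per-plaquette ∕ per-bond token, split edition -/

section TokenSplit

variable (F : T4Family) (N : ℕ) [NeZero N]

/-- ★★ **[15] (165) IN A SPLIT LOCAL GAUGE AROUND EVERY CORE PLAQUETTE ∕ BOND, ROAD R0′ — TOKEN FORM**: the binder block of `HalvingStepTop` ∕ `LocalLetters165TopStepCore` BYTE FOR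
BYTE; conclusion: for every level `m ≤ k`, every CORE plaquette `p` of the level-`m` top class (`p ∉ Sect2.printedPlaqs s.Ω k 0`) lies in `plaqInside Y`, and every CORE bond
(`b ∉ Sect2.bondsDeep (Ω 1)ᶜ`) in `Sect2.bondsDeep Y`, for some site set `Y` and some level `i`, `m ≤ i ≤ k`, with `LocalGaugeSplitOn Y η_i (κ·ε_i) (C·δ_i + θ·ε_i + Q·ε_i²) U`
— the FULL potential (incl. the shear's fine pure gauge `∂μ`) and its gradient below `κ·ε_i` (print: the shear is `O(ε₀)`), the (165)-letters of the curl-free-complement `A₀`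
below the R4 budget `C·δ_i + θ·ε_i + Q·ε_i²` (p584895 §3: `C` = «⅛B₃» the near data part, `θ` the small far-site coefficient of (161)∕(163), `Q` = «B₀(C₄ + 4C₂)(36dL²B₁R₁M₁)²»).
A `Prop`, NEVER asserted; its discharge is the Sect. F chain on `□` under R0′.
-- TODO(general form): ONE threshold ε₁ and ONE radius ε₀ in print; general admissible `{Ω_j}`; print's (82) tangent criticality; print's (165) bounds also `|Δ^ηA|`.
[cite: Balaban1985Variational, (165) p.304, (152) p.301, (159) p.303, p.302, Sect. F pp.300–304, (2)–(8) pp.278–279; Balaban1985RegularSpaces, (1.7)–(1.9) p.77, (1.54) p.85; Balaban1988Convergent, (2.12) p.256] -/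
def LocalLettersSplitTopStepCore (Sup : (ν : Stage7Numerics) → (K : ℕ) → (ℕ → Set (Site (F.P K) 0)) → Set (Site (F.P K) 0)) (B₃ C θ Q κ a₀ a₁ : ℝ) : Prop :=
  ∀ (ν : Stage7Numerics) (M : ℕ) (g : ℕ → ℝ) (K k : ℕ) (s : SeqOfRecord F ν M g K k), Sect2.SeqSeparated ν.M₁ s → 0 < ν.M₁ → 1 ≤ k →
    ∀ (ε δ : ℕ → ℝ),
    (∀ n, n ≤ k → 0 < δ n ∧ δ n ≤ a₁) → (∀ n, n < k → δ n ≤ 2 * δ (n + 1)) → (∀ n, n < k → δ (n + 1) ≤ 2 * δ n) →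
    (∀ n, n ≤ k → B₃ * δ n ≤ ε n ∧ ε n ≤ a₀) → (∀ n, n < k → ε n ≤ 2 * ε (n + 1)) → (∀ n, n < k → ε (n + 1) ≤ 2 * ε n) →
    ∀ W : MSField (F.P K) (SU N), Sect2.DataSmall7PTop (avOfRecord F N K) s.Ω (Sup ν K s.Ω) k δ W →
      ∀ U : GaugeField (F.P K) 0 (SU N),
        (∀ n, n ≤ k → PlaqSmallOn (Sect2.omegaPlaqsTop s.Ω (Sup ν K s.Ω) n) (ε n * (F.P K).eta n ^ 2) U) →
        (∀ n, n ≤ k → Sect2.CoDivSmallOn (Sect2.omegaBondsTop s.Ω (Sup ν K s.Ω) n) (ε n * (F.P K).eta n ^ 3) U) →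
        AgreeOn (genSet s.Ω k) (avgFamily (avOfRecord F N K) U) W →
        IsCritOnFibre F N K (genSet s.Ω k) W U →
        ∀ m, m ≤ k →
          (∀ p ∈ Sect2.omegaPlaqsTop s.Ω (Sup ν K s.Ω) m, p ∉ Sect2.printedPlaqs s.Ω k 0 →
            ∃ (Y : Set (Site (F.P K) 0)) (i : ℕ), m ≤ i ∧ i ≤ k ∧ p ∈ plaqInside Y ∧
              LocalGaugeSplitOn Y ((F.P K).eta i) (κ * ε i) (C * δ i + θ * ε i + Q * ε i ^ 2) U) ∧
          (∀ b ∈ Sect2.omegaBondsTop s.Ω (Sup ν K s.Ω) m, b ∉ Sect2.bondsDeep (s.Ω 1)ᶜ →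
            ∃ (Y : Set (Site (F.P K) 0)) (i : ℕ), m ≤ i ∧ i ≤ k ∧ b ∈ Sect2.bondsDeep Y ∧
              LocalGaugeSplitOn Y ((F.P K).eta i) (κ * ε i) (C * δ i + θ * ε i + Q * ε i ^ 2) U)

variable {F N}

/-- The R4 budget is below `κ·ε` once `κ ≥ C∕B₃ + θ + Q·a₀` (`B₃ > 0`, `B₃δ ≤ ε ≤ a₀`, `C, Q ≥ 0`). [cite: Balaban1985Variational, (162)–(166) pp.303–304 (bookkeeping)] -/
private theorem budget_le_kappa {B₃ C θ Q κ a₀ δ ε : ℝ} (hB₃ : 0 < B₃) (hC : 0 ≤ C) (hQ : 0 ≤ Q) (hκ : C / B₃ + θ + Q * a₀ ≤ κ) (hε : B₃ * δ ≤ ε)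
    (hεa : ε ≤ a₀) (hε0 : 0 ≤ ε) : C * δ + θ * ε + Q * ε ^ 2 ≤ κ * ε := by
  have hδ : δ ≤ ε / B₃ := by rw [le_div_iff₀ hB₃]; linarith
  have h1 : C * δ ≤ C / B₃ * ε := by
    calc C * δ ≤ C * (ε / B₃) := mul_le_mul_of_nonneg_left hδ hC
      _ = C / B₃ * ε := by ring
  have h2 : Q * ε ^ 2 ≤ Q * a₀ * ε := by
    have := mul_le_mul_of_nonneg_left hεa (mul_nonneg hQ hε0)
    nlinarith
  calc C * δ + θ * ε + Q * ε ^ 2 ≤ C / B₃ * ε + θ * ε + Q * a₀ * ε := by linarith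
    _ = (C / B₃ + θ + Q * a₀) * ε := by ring
    _ ≤ κ * ε := mul_le_mul_of_nonneg_right hκ hε0

/-- **THE R4 EDITION IMPLIES THE R0′ EDITION** (`G := 0`): the one-threshold token `LocalLetters165TopStepCore F N Sup B₃ C θ Q a₀ a₁` (p587134) gives the split token at the
same budget for every `κ ≥ C∕B₃ + θ + Q·a₀` (`B₃ > 0`, `C, Q ≥ 0`; the full potential is then `A₀` itself, below `C·δ_i + θ·ε_i + Q·ε_i² ≤ κ·ε_i`).
[cite: Balaban1985Variational, (165) p.304, (162)–(166) pp.303–304 (bookkeeping)] -/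
theorem localLettersSplitCore_of_localLetters165Core {Sup : (ν : Stage7Numerics) → (K : ℕ) → (ℕ → Set (Site (F.P K) 0)) → Set (Site (F.P K) 0)}
    {B₃ C θ Q κ a₀ a₁ : ℝ} (h : LocalLetters165TopStepCore F N Sup B₃ C θ Q a₀ a₁) (hB₃ : 0 < B₃) (hC : 0 ≤ C) (hQ : 0 ≤ Q)
    (hκ : C / B₃ + θ + Q * a₀ ≤ κ) : LocalLettersSplitTopStepCore F N Sup B₃ C θ Q κ a₀ a₁ := by
  intro ν M g K k s hsep hM₁ hk ε δ hδ hcomp hcomp' hε hεcomp hεcomp' W h7 U h17 h19 hfib hcrit m hm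
  have htok := h ν M g K k s hsep hM₁ hk ε δ hδ hcomp hcomp' hε hεcomp hεcomp' W h7 U h17 h19 hfib hcrit m hm
  have hbud : ∀ i, i ≤ k → C * δ i + θ * ε i + Q * ε i ^ 2 ≤ κ * ε i := fun i hi =>
    budget_le_kappa hB₃ hC hQ hκ (hε i hi).1 (hε i hi).2 ((mul_nonneg hB₃.le (hδ i hi).1.le).trans (hε i hi).1)
  refine ⟨fun p hp hpc => ?_, fun b hb hbc => ?_⟩
  · obtain ⟨Y, i, hmi, hik, hpY, hg⟩ := htok.1 p hp hpc
    exact ⟨Y, i, hmi, hik, hpY, localGaugeSplitOn_of_localGauge10On hg (hbud i hik)⟩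
  · obtain ⟨Y, i, hmi, hik, hbY, hg⟩ := htok.2 b hb hbc
    exact ⟨Y, i, hmi, hik, hbY, localGaugeSplitOn_of_localGauge10On hg (hbud i hik)⟩

end TokenSplit

/-! ## §3  ★★★ The budget and the closer: the split token gives `HalvingStepTopCore` -/

section Close

variable {F : T4Family} {N : ℕ} [NeZero N]

/-- ★ **PRINT'S (162) «B₃», (163) AND (166) «a₅» FOR THE SPLIT EDITION, PLAQUETTES** (real arithmetic, constants of p609716): with `4C ≤ B₃`, `16θ ≤ 1`, `Q ≥ 0`,
`(16Q + 1024κ²)·a₀ ≤ 1`, `δ > 0`, `0 ≤ ε ≤ a₀`: `2(C·δ + θ·ε + Q·ε²) + 24(κ·ε)² ≤ max{B₃δ, ½ε}` (`2Cδ ≤ ½B₃δ`, `2θε ≤ ⅛ε`, `(2Q + 24κ²)ε² ≤ ⅛ε`).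
[cite: Balaban1985Variational, (162)–(163) pp.303–304, (165)–(167) p.304] -/
theorem thresholdSplit_plaq {B₃ C θ Q κ a₀ δ ε : ℝ} (hC : 4 * C ≤ B₃) (hθ : 16 * θ ≤ 1) (hQ : 0 ≤ Q)
    (ha : (16 * Q + 1024 * κ ^ 2) * a₀ ≤ 1) (hδ : 0 < δ) (hε0 : 0 ≤ ε) (hεa : ε ≤ a₀) :
    2 * (C * δ + θ * ε + Q * ε ^ 2) + 24 * (κ * ε) ^ 2 ≤ max (B₃ * δ) (ε / 2) := by
  have hm1 := le_max_left (B₃ * δ) (ε / 2)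
  have hm2 := le_max_right (B₃ * δ) (ε / 2)
  have hlin : 2 * (C * δ) ≤ 1 / 2 * (B₃ * δ) := by nlinarith
  have hθε : 2 * (θ * ε) ≤ 1 / 4 * (ε / 2) := by nlinarith
  have hqa : (2 * Q + 24 * κ ^ 2) * a₀ ≤ 1 / 8 := by nlinarith [sq_nonneg κ]
  have hquad : (2 * Q + 24 * κ ^ 2) * ε ^ 2 ≤ 1 / 4 * (ε / 2) := by
    have h1 : (2 * Q + 24 * κ ^ 2) * ε ^ 2 ≤ (2 * Q + 24 * κ ^ 2) * a₀ * ε := by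
      have hc : 0 ≤ (2 * Q + 24 * κ ^ 2) * ε := mul_nonneg (by positivity) hε0
      nlinarith
    nlinarith
  calc 2 * (C * δ + θ * ε + Q * ε ^ 2) + 24 * (κ * ε) ^ 2 = 2 * (C * δ) + 2 * (θ * ε) + (2 * Q + 24 * κ ^ 2) * ε ^ 2 := by ring
    _ ≤ 1 / 2 * (B₃ * δ) + 1 / 4 * (ε / 2) + 1 / 4 * (ε / 2) := add_le_add (add_le_add hlin hθε) hquad
    _ ≤ 1 / 2 * max (B₃ * δ) (ε / 2) + 1 / 4 * max (B₃ * δ) (ε / 2) + 1 / 4 * max (B₃ * δ) (ε / 2) := by gcongr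
    _ = max (B₃ * δ) (ε / 2) := by ring

/-- ★ **THE SAME BUDGET FOR THE BONDS** (`d = 4`: `t₀ + 32·4·t²`): `(C·δ + θ·ε + Q·ε²) + 128(κ·ε)² ≤ max{B₃δ, ½ε}` under the same smallness and `B₃ ≥ 0`.
[cite: Balaban1985Variational, (162)–(163) pp.303–304, (165)–(167) p.304] -/
theorem thresholdSplit_bond {B₃ C θ Q κ a₀ δ ε : ℝ} (hB₃ : 0 ≤ B₃) (hC : 4 * C ≤ B₃) (hθ : 16 * θ ≤ 1) (hQ : 0 ≤ Q)
    (ha : (16 * Q + 1024 * κ ^ 2) * a₀ ≤ 1) (hδ : 0 < δ) (hε0 : 0 ≤ ε) (hεa : ε ≤ a₀) :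
    (C * δ + θ * ε + Q * ε ^ 2) + 32 * 4 * (κ * ε) ^ 2 ≤ max (B₃ * δ) (ε / 2) := by
  have hm1 := le_max_left (B₃ * δ) (ε / 2)
  have hm2 := le_max_right (B₃ * δ) (ε / 2)
  have hlin : C * δ ≤ 1 / 2 * (B₃ * δ) := by nlinarith
  have hθε : θ * ε ≤ 1 / 4 * (ε / 2) := by nlinarith
  have hqa : (Q + 128 * κ ^ 2) * a₀ ≤ 1 / 8 := by nlinarith [sq_nonneg κ]
  have hquad : (Q + 128 * κ ^ 2) * ε ^ 2 ≤ 1 / 4 * (ε / 2) := by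
    have h1 : (Q + 128 * κ ^ 2) * ε ^ 2 ≤ (Q + 128 * κ ^ 2) * a₀ * ε := by
      have hc : 0 ≤ (Q + 128 * κ ^ 2) * ε := mul_nonneg (by positivity) hε0
      nlinarith
    nlinarith
  calc (C * δ + θ * ε + Q * ε ^ 2) + 32 * 4 * (κ * ε) ^ 2 = C * δ + θ * ε + (Q + 128 * κ ^ 2) * ε ^ 2 := by ring
    _ ≤ 1 / 2 * (B₃ * δ) + 1 / 4 * (ε / 2) + 1 / 4 * (ε / 2) := add_le_add (add_le_add hlin hθε) hquad
    _ ≤ 1 / 2 * max (B₃ * δ) (ε / 2) + 1 / 4 * max (B₃ * δ) (ε / 2) + 1 / 4 * max (B₃ * δ) (ε / 2) := by gcongr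
    _ = max (B₃ * δ) (ε / 2) := by ring

/-- ★★★ **«HENCE U_k BELONGS TO THE SPACE (2) WITH max{B₃ε₁, ½ε₀} INSTEAD OF ε₀», ROAD R0′** ([15] p. 304, the last two sentences of the one-step improvement, with the
sheared datum): the split token `LocalLettersSplitTopStepCore F N Sup B₃ C θ Q κ a₀ a₁` gives k0-s1-w3's `HalvingStepTopCore F N Sup B₃ a₀ a₁` as soon as `B₃ ≥ max{4C, 0}`,
`θ ≤ 1∕16` (print's (163)), `Q, κ ≥ 0`, `(16Q + 1024κ²)·a₀ ≤ 1` and `32κ·a₀ ≤ 1` (print's (166) «ε₀ ≦ a₅»: the quadratic terms — incl. the shear's `24t²` — are beaten by the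
smallness of the class radius): per core plaquette ∕ bond the split local gauge at unit `η_i` yields (1.7) at `(2t₀ + 24t²)·η_i²` on `plaqInside Y` and (1.9) at
`(t₀ + 128t²)·η_i³` on `bondsDeep Y` (dag-n07-w8's `regularTwo_of_curlFreeShift` through `regularTwo_of_localGaugeSplitOn`; side condition `32t = 32κε_i ≤ 32κa₀ ≤ 1`, `d = 4`),
`thresholdSplit_plaq ∕ _bond` put both below the improved radius at level `i`, and p584895's `radius_descend` carries it to the level `m ≤ i` of the clause.  By k0-s1-w3's
`halvingStepTop_of_core`, module 30 and n21-c's socket this is ALSO «split token ⇒ stub 1» by name; the token is a HYPOTHESIS here.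
[cite: Balaban1985Variational, (165)–(168) p.304, (162)–(163) pp.303–304, p.302, Prop. 8 p.304, (2)–(8) pp.278–279; Balaban1985RegularSpaces, (1.7)–(1.9) p.77, (1.54) p.85, Prop. 7 (1.144) p.100] -/
theorem halvingStepTopCore_of_localLettersSplitCore {Sup : (ν : Stage7Numerics) → (K : ℕ) → (ℕ → Set (Site (F.P K) 0)) → Set (Site (F.P K) 0)}
    {B₃ C θ Q κ a₀ a₁ : ℝ} (h : LocalLettersSplitTopStepCore F N Sup B₃ C θ Q κ a₀ a₁) (hB₃ : 0 ≤ B₃) (hC : 4 * C ≤ B₃) (hθ : 16 * θ ≤ 1)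
    (hQ : 0 ≤ Q) (hκ : 0 ≤ κ) (ha : (16 * Q + 1024 * κ ^ 2) * a₀ ≤ 1) (hκa : 32 * κ * a₀ ≤ 1) : HalvingStepTopCore F N Sup B₃ a₀ a₁ := by
  intro ν M g K k s hsep hM₁ hk ε δ hδ hcomp hcomp' hε hεcomp hεcomp' W h7 U h17 h19 hfib hcrit
  have htok := h ν M g K k s hsep hM₁ hk ε δ hδ hcomp hcomp' hε hεcomp hεcomp' W h7 U h17 h19 hfib hcrit
  have hδpos : ∀ n, n ≤ k → 0 < δ n := fun n hn => (hδ n hn).1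
  have hε0 : ∀ n, n ≤ k → 0 ≤ ε n := fun n hn => (mul_nonneg hB₃ (hδpos n hn).le).trans (hε n hn).1
  -- the side condition `32·(κ·ε_i) ≤ 1` of p609716
  have h32 : ∀ i, i ≤ k → 32 * (κ * ε i) ≤ 1 := fun i hi => by
    calc 32 * (κ * ε i) = 32 * κ * ε i := by ring
      _ ≤ 32 * κ * a₀ := mul_le_mul_of_nonneg_left (hε i hi).2 (by positivity)
      _ ≤ 1 := hκa
  have hd : ((F.P K).d : ℝ) = 4 := by exact_mod_cast T4Family.P_d F K
  refine ⟨fun m hm p hp hpc => ?_, fun m hm b hb hbc => ?_⟩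
  · obtain ⟨Y, i, hmi, hik, hpY, hg⟩ := (htok m hm).1 p hp hpc
    have hη := eta_pos_le_one' (F.P K) i
    have h1 := (regularTwo_of_localGaugeSplitOn hg hη.1 hη.2 (h32 i hik)).1 p hpY
    have hbud := thresholdSplit_plaq hC hθ hQ ha (hδpos i hik) (hε0 i hik) (hε i hik).2
    calc dist1 (GaugeField.plaqHol U p) < (2 * (C * δ i + θ * ε i + Q * ε i ^ 2) + 24 * (κ * ε i) ^ 2) * (F.P K).eta i ^ 2 := h1
      _ ≤ max (B₃ * δ i) (ε i / 2) * (F.P K).eta i ^ 2 := mul_le_mul_of_nonneg_right hbud (pow_nonneg hη.1.le 2)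
      _ ≤ max (B₃ * δ m) (ε m / 2) * (F.P K).eta m ^ 2 := radius_descend (F.P K) hB₃ hδpos hcomp' hεcomp' one_le_two hmi hik
  · obtain ⟨Y, i, hmi, hik, hbY, hg⟩ := (htok m hm).2 b hb hbc
    have hη := eta_pos_le_one' (F.P K) i
    have h1 := (regularTwo_of_localGaugeSplitOn hg hη.1 hη.2 (h32 i hik)).2 b hbY
    have hbud := thresholdSplit_bond hB₃ hC hθ hQ ha (hδpos i hik) (hε0 i hik) (hε i hik).2
    rw [hd] at h1
    calc ‖Sect2.coDivSum U b.src b.dir‖ < (C * δ i + θ * ε i + Q * ε i ^ 2 + 32 * 4 * (κ * ε i) ^ 2) * (F.P K).eta i ^ 3 := h1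
      _ ≤ max (B₃ * δ i) (ε i / 2) * (F.P K).eta i ^ 3 := mul_le_mul_of_nonneg_right hbud (pow_nonneg hη.1.le 3)
      _ ≤ max (B₃ * δ m) (ε m / 2) * (F.P K).eta m ^ 3 := radius_descend (F.P K) hB₃ hδpos hcomp' hεcomp' (by norm_num) hmi hik

end Close

/-! ## §4  ★★ The per-datum token, split edition, and its reduction -/

section DatumSplit

variable (F : T4Family) (N : ℕ) [NeZero N]

/-- ★★ **[15] (165) IN THE SPLIT GAUGE OF THE BIG CUBE `□`, PER DATA CUBE, ROAD R0′ — TOKEN FORM**: the binder block of `HalvingStepTop` BYTE FOR BYTE; conclusion: for every level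
`1 ≤ j ≤ k` and every grid index `a` whose level-`j` `Mc`-cube has a point within `3` of a lift of a site of `Ω_j` (INTENT-1's `Within 3` meeting condition), `U` carries the SPLIT
local gauge `LocalGaugeSplitOn Y η_j (κ·ε_j) (C·δ_j + θ·ε_j + Q·ε_j²) U` on the window `Y = π(□)`, `□ = box L (cornerP Mc ρ a) (sideP Mc ρ) j` of the print datum `propCubeP j Mc ρ a`
(door (a)).  The sentence the R0′ supply rows deliver into: S3's gauge on `□`, the (159) split `A₀ = A₁ + HB″ − HD(…)` with its letters (this seat's doors + piece 4), the shear `G =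
∂μ = H(∂_cλ)` ((r0)∕(r1), n07-e ∕ w6 ∕ w7) with its size `κ·ε_j` ((r2)∕(r3)).  `Mc`, `ρ` FREE.  A `Prop`, NEVER asserted.
-- TODO(general form): as for `LocalLettersSplitTopStepCore`.
[cite: Balaban1985Variational, (165) p.304, p.302, (144) p.300, (152) p.301, (159) p.303; Balaban1985RegularSpaces, (1.7)–(1.9) p.77, (1.130)–(1.131) p.99; Balaban1988Convergent, (2.12)–(2.13) p.256] -/
def DatumGaugeSplitTopStepCore (Sup : (ν : Stage7Numerics) → (K : ℕ) → (ℕ → Set (Site (F.P K) 0)) → Set (Site (F.P K) 0)) (Mc ρ : ℕ)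
    (B₃ C θ Q κ a₀ a₁ : ℝ) : Prop :=
  ∀ (ν : Stage7Numerics) (M : ℕ) (g : ℕ → ℝ) (K k : ℕ) (s : SeqOfRecord F ν M g K k), Sect2.SeqSeparated ν.M₁ s → 0 < ν.M₁ → 1 ≤ k →
    ∀ (ε δ : ℕ → ℝ),
    (∀ n, n ≤ k → 0 < δ n ∧ δ n ≤ a₁) → (∀ n, n < k → δ n ≤ 2 * δ (n + 1)) → (∀ n, n < k → δ (n + 1) ≤ 2 * δ n) →
    (∀ n, n ≤ k → B₃ * δ n ≤ ε n ∧ ε n ≤ a₀) → (∀ n, n < k → ε n ≤ 2 * ε (n + 1)) → (∀ n, n < k → ε (n + 1) ≤ 2 * ε n) →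
    ∀ W : MSField (F.P K) (SU N), Sect2.DataSmall7PTop (avOfRecord F N K) s.Ω (Sup ν K s.Ω) k δ W →
      ∀ U : GaugeField (F.P K) 0 (SU N),
        (∀ n, n ≤ k → PlaqSmallOn (Sect2.omegaPlaqsTop s.Ω (Sup ν K s.Ω) n) (ε n * (F.P K).eta n ^ 2) U) →
        (∀ n, n ≤ k → Sect2.CoDivSmallOn (Sect2.omegaBondsTop s.Ω (Sup ν K s.Ω) n) (ε n * (F.P K).eta n ^ 3) U) →
        AgreeOn (genSet s.Ω k) (avgFamily (avOfRecord F N K) U) W →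
        IsCritOnFibre F N K (genSet s.Ω k) W U →
        ∀ j, 1 ≤ j → j ≤ k → ∀ a : Pt (F.P K).d,
          (∃ x y : Pt (F.P K).d, x ∈ cubeExt (side (F.P K).L Mc j) a 0 ∧ cover (F.P K) y ∈ s.Ω j ∧ Within ((3 : ℕ) : ℤ) x y) →
          LocalGaugeSplitOn (cover (F.P K) '' box (F.P K).L (cornerP (F.P K) Mc ρ a) (sideP (F.P K) Mc ρ) j)
            ((F.P K).eta j) (κ * ε j) (C * δ j + θ * ε j + Q * ε j ^ 2) U

variable {F N}

/-- ★★ **THE ∃-INTRODUCTION OF THE S6 HEAD, SPLIT EDITION** (INTENT-1's `localLetters165Core_of_datumGauge165Core` with the split clause in place of 33b's): the per-datum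
split token gives the per-plaquette ∕ per-bond split token for `Mc ≥ 1`, `ρ ≥ L` — level from p594564's `Sect2.exists_level_of_core_plaq ∕ _bond`, grid cube of `lift p₋` ∕
`lift b₋ − 𝟙` with its `Within 3` witness (INTENT-1 §2), window stencil from p606159.
[cite: Balaban1985Variational, p.304 («The cube Δ₀ is an arbitrary cube …»), p.302, (165) p.304; Balaban1985RegularSpaces, (1.7)–(1.9) p.77, (1.2) p.76; Balaban1988Convergent, (2.12)–(2.13) p.256] -/
theorem localLettersSplitCore_of_datumGaugeSplitCore {Sup : (ν : Stage7Numerics) → (K : ℕ) → (ℕ → Set (Site (F.P K) 0)) → Set (Site (F.P K) 0)}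
    {Mc ρ : ℕ} (hMc : 1 ≤ Mc) (hρ : F.L ≤ ρ) {B₃ C θ Q κ a₀ a₁ : ℝ} (h : DatumGaugeSplitTopStepCore F N Sup Mc ρ B₃ C θ Q κ a₀ a₁) :
    LocalLettersSplitTopStepCore F N Sup B₃ C θ Q κ a₀ a₁ := by
  intro ν M g K k s hsep hM₁ hk ε δ hδ hcomp hcomp' hε hεcomp hεcomp' W h7 U h17 h19 hfib hcrit m hm
  have hD := h ν M g K k s hsep hM₁ hk ε δ hδ hcomp hcomp' hε hεcomp hεcomp' W h7 U h17 h19 hfib hcrit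
  have hρK : (F.P K).L ≤ ρ := hρ
  have hS : ∀ j, 0 < side (F.P K).L Mc j := fun j => B14.Eq213MaximalDomains.side_pos (F.P K).L_pos hMc j
  refine ⟨fun p hp hcore => ?_, fun b hb hcore => ?_⟩
  · obtain ⟨j, hmj, hjk, hpj⟩ := Sect2.exists_level_of_core_plaq hk hm hp hcore
    have hj : 1 ≤ j := le_trans (le_max_right m 1) hmj
    obtain ⟨y, hy, hxy⟩ := exists_within_three_of_mem_plaqsOf hpj
    have hg := hD j hj hjk (cubeIdx (side (F.P K).L Mc j) (lift (F.P K) p.src))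
      ⟨lift (F.P K) p.src, y, mem_cubeExt_cubeIdx (hS j) _, hy, hxy⟩
    exact ⟨_, j, le_trans (le_max_left m 1) hmj, hjk, Sect2.mem_plaqInside_cover_box_propCubeP p hj hMc hρK, hg⟩
  · obtain ⟨j, hmj, hjk, hbj⟩ := Sect2.exists_level_of_core_bond hk hm hb hcore
    have hj : 1 ≤ j := le_trans (le_max_right m 1) hmj
    obtain ⟨y, hy, hxy⟩ := exists_within_three_of_not_mem_bondsDeep_compl hbj
    have hg := hD j hj hjk (cubeIdx (side (F.P K).L Mc j) (lift (F.P K) b.src - fun _ => 1))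
      ⟨lift (F.P K) b.src - fun _ => 1, y, mem_cubeExt_cubeIdx (hS j) _, hy, hxy⟩
    exact ⟨_, j, le_trans (le_max_left m 1) hmj, hjk, Sect2.mem_bondsDeep_cover_box_propCubeP b hj hMc hρK, hg⟩

/-- ★★ **THE PER-DATUM SPLIT GAUGES CLOSE THE ONE-STEP IMPROVEMENT ON THE CORE, ROAD R0′** (composition of §4 with §3): for `Mc ≥ 1`, `ρ ≥ L` and the smallness of
`halvingStepTopCore_of_localLettersSplitCore`, the per-datum split token gives `HalvingStepTopCore F N Sup B₃ a₀ a₁` — hence stub 1's body by name (k0-s1-w3, module 30, n21-c).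
The token is a HYPOTHESIS. [cite: Balaban1985Variational, (165)–(168) p.304, (162)–(163) pp.303–304, Prop. 8 p.304; Balaban1985RegularSpaces, (1.7)–(1.9) p.77, (1.54) p.85] -/
theorem halvingStepTopCore_of_datumGaugeSplitCore {Sup : (ν : Stage7Numerics) → (K : ℕ) → (ℕ → Set (Site (F.P K) 0)) → Set (Site (F.P K) 0)}
    {Mc ρ : ℕ} (hMc : 1 ≤ Mc) (hρ : F.L ≤ ρ) {B₃ C θ Q κ a₀ a₁ : ℝ} (h : DatumGaugeSplitTopStepCore F N Sup Mc ρ B₃ C θ Q κ a₀ a₁)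
    (hB₃ : 0 ≤ B₃) (hC : 4 * C ≤ B₃) (hθ : 16 * θ ≤ 1) (hQ : 0 ≤ Q) (hκ : 0 ≤ κ) (ha : (16 * Q + 1024 * κ ^ 2) * a₀ ≤ 1)
    (hκa : 32 * κ * a₀ ≤ 1) : HalvingStepTopCore F N Sup B₃ a₀ a₁ :=
  halvingStepTopCore_of_localLettersSplitCore (localLettersSplitCore_of_datumGaugeSplitCore hMc hρ h) hB₃ hC hθ hQ hκ ha hκa

end DatumSplit

end Summit.QuantumFields.YangMills.BalabanUVNodes.N07LocalLettersSplitCore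

end
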